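import Mathlib
import HarnessLib
import Literature.Probability.MarkovChains.SpectralProfileComparison
import Literature.Probability.MarkovChains.ModerateGrowthNashInequality

/-!
# The spectral profile from volume growth and a local Poincaré inequality — `Λ(v) ≥ 1/(4aW²(2v))` (Goel–Montenegro–Tetali 2006, Theorem 4.1, Corollary 4.2)

HONEST FRAMING: exact (Metropolis-corrected) sampling algorithms for lattice gauge theory; figures
of merit are autocorrelation/cost numbers at stated couplings and volumes; no continuum-physics claim.

Source (READ on the hub's materialised text, §4.2.1 "Walks with Moderate Growth", pp. 10–11):
S. Goel, R. Montenegro, P. Tetali, *Mixing time bounds via the spectral profile*, Electron. J.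
Probab. **11** (2006) 1–26 = math.PR/0505690 [GoelMontenegroTetali2006]: DEFINITIONS 4.2 / 4.3,
THEOREM 4.1 with its printed proof ("`‖f‖₂² = ⟨f − f_r, f⟩ + ⟨f_r, f⟩ ≤ ‖f − f_r‖₂·‖f‖₂ + ⟨f_r, f⟩`",
"`⟨f_r, f⟩ ≤ V_*(r)⁻¹‖f‖₁² ≤ (π(S)/V_*(r))‖f‖₂²`", "choosing `r = W(2π(S))` we have `1 ≤ √a r
𝓔(f,f)^{1/2}/‖f‖₂ + 1/2`") and the first display of the proof of COROLLARY 4.2 ("`W(v) ≤ γ(Av)^{1/d}`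
… `Λ(v) ≥ 1/(4aW²(2v))`").  Everything below is PROVED (finite sums; 0 named facts).

VOCABULARY (the tree's, as in `ModerateGrowthNashInequality.lean`): a family of finite sets
`B x r` ("balls" `B(x,r)` of the Cayley graph in the source; any family by DSC's Remark 5.4 (2)),
volumes `V(x,r) = π(B(x,r)) = Σ_{y ∈ B(x,r)} π(y)`, averages `f_r = setAverage π B r f`; `𝓔 =
dirichletForm π P`, `‖f‖₂² = piInner π f f`, `‖f‖₁ = E_π|f| = lawMean π |f|`; `λ₀(S) =
dirichletEigenvalue₀`, `λ(S) = dirichletEigenvalue`, `Λ = spectralProfile` (`SpectralProfile.lean`).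
`V_*(r) ≥ v` is typed `∀ x, v ≤ V(x,r)` and **`W(v) = inf{r : V_*(r) ≥ v}`** is `volumeGrowthRadius π B v`
(a natural number; `0` if no radius qualifies — then the bounds below read `Λ ≥ 0`).

## Content
* `volumeGrowthRadius` (= `W`), `volumeGrowthRadius_spec` (`V_*(W(v)) ≥ v` once some radius qualifies),
  `volumeGrowthRadius_le` (`W(v) ≤ r` whenever `V_*(r) ≥ v`);
* the printed proof: `piInner_setAverage_le` (`⟨f_r, f⟩ ≤ V_*(r)⁻¹‖f‖₁²`),
  **`GoelMontenegroTetali2006_thm_4_1_core`** (`V_*(r) ≥ 2π(S)`, `f ∈ c₀(S)`, `‖f − f_r‖₂² ≤ ar²𝓔(f,f)`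
  `⇒ ‖f‖₂² ≤ 4ar²𝓔(f,f)`), `GoelMontenegroTetali2006_thm_4_1_eigenvalue₀` (`λ₀(S) ≥ 1/(4ar²)`);
* **THEOREM 4.1** `GoelMontenegroTetali2006_thm_4_1` (`Λ(v) ≥ 1/(4aW²(2v))` for `π_* ≤ v ≤ 1/2`);
* COROLLARY 4.2, first display: `volumeGrowthRadius_le_of_moderateGrowth` (`(A,d)`-moderate growth `⇒
  W(v) ≤ γ(Av)^{1/d}`), `one_le_volumeGrowthRadius` (`W(2v) ≥ 1` for `v ≥ π_*` when `B(x,0) = {x}`) and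
  `GoelMontenegroTetali2006_cor_4_2_profile` (`Λ(v) ≥ 1/(4aγ²(2Av)^{2/d})`).

DECLARED DEVIATION (constants, value-free): the source's display continues "`≥ 1/(8aA^{1/d}γ²
v^{2/d})`"; what its own sentence "`W(v) ≤ γ(Av)^{1/d}`" yields is `1/(4aW²(2v)) ≥ 1/(4aγ²(2Av)^{2/d})`,
which is the form typed here (COROLLARY 4.2 itself only asserts `τ_∞(ε) ≤ C(a,A,d,ε)γ²` with an
unspecified constant, and is not typed: it needs THEOREM 1.1).  NOT HERE: §4.2.1's quoted Nash route
(`ModerateGrowthNashInequality.lean` + Lemma 4.3), the `n`-cycle example, §4.3–4.4.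
-/

namespace Literature.Probability.MarkovChains

open Finset Matrix

variable {X : Type*} [Fintype X] [DecidableEq X] {P : Matrix X X ℝ} {π : X → ℝ}

/-! ## `W(v) = inf {r : V_*(r) ≥ v}` -/

section VolumeRadius

/-- **`W(v) = inf{r : V_*(r) ≥ v}`** for the volume growth function `V_*(r) = inf_x V(x,r)`,
`V(x,r) = π(B(x,r))` (natural-number radii; `0` when no radius has `V_*(r) ≥ v`).
[cite: GoelMontenegroTetali2006, §4.2.1 Theorem 4.1 ("where `W(v) = inf{r : V_*(r) ≥ v}`")] -/
noncomputable def volumeGrowthRadius (π : X → ℝ) (B : X → ℕ → Finset X) (v : ℝ) : ℕ :=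
  sInf {r : ℕ | ∀ x, v ≤ ∑ y ∈ B x r, π y}

omit [Fintype X] [DecidableEq X] in
/-- `V_*(W(v)) ≥ v` as soon as some radius `R` has `V_*(R) ≥ v` (e.g. `R =` the diameter, `v ≤ 1`).
[cite: GoelMontenegroTetali2006, §4.2.1 Theorem 4.1 (definition of `W`)] -/
theorem volumeGrowthRadius_spec {B : X → ℕ → Finset X} {v : ℝ} {R : ℕ} (hR : ∀ x, v ≤ ∑ y ∈ B x R, π y)
    (x : X) : v ≤ ∑ y ∈ B x (volumeGrowthRadius π B v), π y :=
  (Nat.sInf_mem (s := {r : ℕ | ∀ x, v ≤ ∑ y ∈ B x r, π y}) ⟨R, hR⟩) x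

omit [Fintype X] [DecidableEq X] in
/-- `W(v) ≤ r` whenever `V_*(r) ≥ v`. [cite: GoelMontenegroTetali2006, §4.2.1 Theorem 4.1
(definition of `W`)] -/
theorem volumeGrowthRadius_le {B : X → ℕ → Finset X} {v : ℝ} {r : ℕ} (hr : ∀ x, v ≤ ∑ y ∈ B x r, π y) :
    volumeGrowthRadius π B v ≤ r :=
  Nat.sInf_le hr

end VolumeRadius

/-! ## The printed proof of THEOREM 4.1 -/

section Core

omit [DecidableEq X] in
/-- **`⟨f_r, f⟩ ≤ V_*(r)⁻¹‖f‖₁²`**: "`⟨f_r, f⟩ = Σ_x (V(x,r)⁻¹ Σ_{y ∈ B(x,r)} f(y)π(y)) f(x)π(x) ≤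
V_*(r)⁻¹‖f‖₁²`" (`V_*(r) ≥ w > 0`). [cite: GoelMontenegroTetali2006, §4.2.1 proof of Theorem 4.1] -/
theorem piInner_setAverage_le (hπ0 : ∀ y, 0 ≤ π y) {B : X → ℕ → Finset X} {r : ℕ} {w : ℝ}
    (hw : 0 < w) (hV : ∀ x, w ≤ ∑ y ∈ B x r, π y) (f : X → ℝ) :
    piInner π (setAverage π B r f) f ≤ w⁻¹ * lawMean π (fun y => |f y|) ^ 2 := by
  set L := lawMean π (fun y => |f y|) with hL
  have hLdef : L = ∑ x, π x * |f x| := by rw [hL]; rfl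
  have hL0 : 0 ≤ L := by rw [hLdef]; exact sum_nonneg fun y _ => mul_nonneg (hπ0 y) (abs_nonneg _)
  -- `|f_r(x)| ≤ V_*(r)⁻¹‖f‖₁` pointwise
  have hpt : ∀ x, |setAverage π B r f x| ≤ w⁻¹ * L := by
    intro x
    have hVx : 0 < ∑ y ∈ B x r, π y := lt_of_lt_of_le hw (hV x)
    unfold setAverage
    rw [abs_div, abs_of_pos hVx, div_le_iff₀ hVx]
    have hnum : |∑ y ∈ B x r, π y * f y| ≤ L :=
      (abs_sum_le_sum_abs _ _).trans
        ((sum_le_univ_sum_of_nonneg fun y => abs_nonneg _).trans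
          (le_of_eq (by rw [hLdef]; exact sum_congr rfl fun y _ => by rw [abs_mul, abs_of_nonneg (hπ0 y)])))
    calc |∑ y ∈ B x r, π y * f y| ≤ L := hnum
      _ = w⁻¹ * L * w := by field_simp
      _ ≤ w⁻¹ * L * ∑ y ∈ B x r, π y :=
          mul_le_mul_of_nonneg_left (hV x) (mul_nonneg (inv_nonneg.2 hw.le) hL0)
  have key : ∑ x, π x * ((w⁻¹ * L) * |f x|) = (w⁻¹ * L) * ∑ x, π x * |f x| := by
    rw [mul_sum]; exact sum_congr rfl fun x _ => by ring
  calc piInner π (setAverage π B r f) f = ∑ x, π x * (setAverage π B r f x * f x) := rfl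
    _ ≤ ∑ x, π x * ((w⁻¹ * L) * |f x|) := by
        refine sum_le_sum fun x _ => mul_le_mul_of_nonneg_left ?_ (hπ0 x)
        calc setAverage π B r f x * f x ≤ |setAverage π B r f x * f x| := le_abs_self _
          _ = |setAverage π B r f x| * |f x| := abs_mul _ _
          _ ≤ (w⁻¹ * L) * |f x| := mul_le_mul_of_nonneg_right (hpt x) (abs_nonneg _)
    _ = (w⁻¹ * L) * ∑ x, π x * |f x| := key
    _ = w⁻¹ * L ^ 2 := by rw [← hLdef]; ring

/-- **The core of the printed proof of THEOREM 4.1**: if `f ∈ c₀(S)`, `V_*(r) ≥ 2π(S) > 0` and the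
local Poincaré inequality `‖f − f_r‖₂² ≤ ar²𝓔(f,f)` holds for this `f` and `r`, then
**`‖f‖₂² ≤ 4ar²𝓔(f,f)`** ("`‖f‖₂² ≤ √a r 𝓔(f,f)^{1/2}‖f‖₂ + (π(S)/V_*(r))‖f‖₂²` … `1 ≤ √a r
𝓔(f,f)^{1/2}/‖f‖₂ + 1/2` and the result follows"). [cite: GoelMontenegroTetali2006, §4.2.1 proof of
Theorem 4.1] -/
theorem GoelMontenegroTetali2006_thm_4_1_core (hπ0 : ∀ y, 0 ≤ π y) (hP0 : ∀ x y, 0 ≤ P x y)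
    {B : X → ℕ → Finset X} {S : Finset X} {f : X → ℝ} {a : ℝ} {r : ℕ}
    (hsupp : ∀ x, x ∉ S → f x = 0) (hS : 0 < ∑ x ∈ S, π x)
    (hV : ∀ x, 2 * ∑ x ∈ S, π x ≤ ∑ y ∈ B x r, π y)
    (hloc : piInner π (fun x => f x - setAverage π B r f x) (fun x => f x - setAverage π B r f x) ≤
      a * (r : ℝ) ^ 2 * dirichletForm π P f) :
    piInner π f f ≤ 4 * a * (r : ℝ) ^ 2 * dirichletForm π P f := by
  set N := piInner π f f with hN
  set D := piInner π (fun x => f x - setAverage π B r f x) (fun x => f x - setAverage π B r f x)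
  have hN0 : 0 ≤ N := piInner_self_nonneg hπ0 f
  have hE0 : 0 ≤ dirichletForm π P f := dirichletForm_nonneg hπ0 hP0 f
  -- `‖f‖₂² = ⟨f − f_r, f⟩ + ⟨f_r, f⟩`
  have hsplit : N = piInner π (fun x => f x - setAverage π B r f x) f + piInner π (setAverage π B r f) f := by
    rw [hN]; unfold piInner; rw [← sum_add_distrib]; exact sum_congr rfl fun x _ => by ring
  -- `⟨f_r, f⟩ ≤ (π(S)/V_*(r))‖f‖₂² ≤ ½‖f‖₂²`
  have h2S : 0 < 2 * ∑ x ∈ S, π x := by linarith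
  have havg : piInner π (setAverage π B r f) f ≤ N / 2 := by
    have h1 := piInner_setAverage_le hπ0 h2S hV f
    have h2 := lawMean_abs_sq_le hπ0 hsupp (π := π) (f := f)
    calc piInner π (setAverage π B r f) f ≤ (2 * ∑ x ∈ S, π x)⁻¹ * lawMean π (fun y => |f y|) ^ 2 := h1
      _ ≤ (2 * ∑ x ∈ S, π x)⁻¹ * ((∑ x ∈ S, π x) * N) :=
          mul_le_mul_of_nonneg_left h2 (inv_nonneg.2 h2S.le)
      _ = N / 2 := by field_simp
  -- Cauchy–Schwarz: `⟨f − f_r, f⟩² ≤ ‖f − f_r‖₂²‖f‖₂² ≤ ar²𝓔(f,f)‖f‖₂²`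
  have hcs : piInner π (fun x => f x - setAverage π B r f x) f ^ 2 ≤ D * N :=
    piInner_sq_le_mul hπ0 _ _
  have hhalf : N / 2 ≤ piInner π (fun x => f x - setAverage π B r f x) f := by linarith
  have hsq : (N / 2) ^ 2 ≤ a * (r : ℝ) ^ 2 * dirichletForm π P f * N :=
    calc (N / 2) ^ 2 ≤ piInner π (fun x => f x - setAverage π B r f x) f ^ 2 :=
          pow_le_pow_left₀ (by linarith) hhalf 2
      _ ≤ D * N := hcs
      _ ≤ a * (r : ℝ) ^ 2 * dirichletForm π P f * N := mul_le_mul_of_nonneg_right hloc hN0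
  have hD0 : 0 ≤ D := piInner_self_nonneg hπ0 _
  have haE : 0 ≤ a * (r : ℝ) ^ 2 * dirichletForm π P f := hD0.trans hloc
  rcases hN0.eq_or_lt with hN00 | hNpos
  · rw [← hN00]; linarith
  · have h' : N / 4 * N ≤ a * (r : ℝ) ^ 2 * dirichletForm π P f * N := by nlinarith [hsq]
    have h'' := le_of_mul_le_mul_right h' hNpos
    linarith

/-- **`λ₀(S) ≥ 1/(4ar²)`** under the hypotheses of THEOREM 4.1 at the set `S`: `V_*(r) ≥ 2π(S)`
and the local Poincaré inequality at radius `r` for every `f ∈ c₀(S)` (`S ≠ ∅`, `π > 0`, `ar² > 0`).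
[cite: GoelMontenegroTetali2006, §4.2.1 proof of Theorem 4.1 ("It is sufficient to show that
`𝓔(f,f)/‖f‖₂² ≥ 1/(4aW²(2π(S)))`")] -/
theorem GoelMontenegroTetali2006_thm_4_1_eigenvalue₀ (hπ : ∀ y, 0 < π y) (hP0 : ∀ x y, 0 ≤ P x y)
    {B : X → ℕ → Finset X} {S : Finset X} (hSne : S.Nonempty) {a : ℝ} {r : ℕ}
    (har : 0 < a * (r : ℝ) ^ 2) (hV : ∀ x, 2 * ∑ x ∈ S, π x ≤ ∑ y ∈ B x r, π y)
    (hloc : ∀ f : X → ℝ, (∀ x, x ∉ S → f x = 0) → piInner π (fun x => f x - setAverage π B r f x)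
      (fun x => f x - setAverage π B r f x) ≤ a * (r : ℝ) ^ 2 * dirichletForm π P f) :
    (4 * a * (r : ℝ) ^ 2)⁻¹ ≤ dirichletEigenvalue₀ π P S := by
  have hπ0 : ∀ y, 0 ≤ π y := fun y => (hπ y).le
  have hS : 0 < ∑ x ∈ S, π x := sum_pos (fun x _ => hπ x) hSne
  -- the index set of `λ₀(S)` is non-empty: the indicator of a point of `S`
  obtain ⟨x₀, hx₀⟩ := hSne
  have hf₀ : (fun x => if x = x₀ then (1:ℝ) else 0) ∈
      {f : X → ℝ | (∀ x, x ∉ S → f x = 0) ∧ 0 < piInner π f f} := by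
    refine ⟨fun x hx => if_neg (fun h : x = x₀ => hx (by rw [h]; exact hx₀)), ?_⟩
    unfold piInner
    have : ∑ x, π x * ((if x = x₀ then (1:ℝ) else 0) * (if x = x₀ then (1:ℝ) else 0)) = π x₀ := by
      rw [sum_eq_single x₀ (fun x _ hx => by simp [hx]) (fun h => absurd (mem_univ x₀) h)]; simp
    rw [this]; exact hπ x₀
  refine le_csInf ⟨_, ⟨_, hf₀, rfl⟩⟩ ?_
  rintro _ ⟨f, ⟨hsupp, hff⟩, rfl⟩
  rw [le_div_iff₀ hff]
  have h := GoelMontenegroTetali2006_thm_4_1_core hπ0 hP0 hsupp hS hV (hloc f hsupp)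
  have h4 : 0 < 4 * a * (r : ℝ) ^ 2 := by linarith
  calc (4 * a * (r : ℝ) ^ 2)⁻¹ * piInner π f f ≤ (4 * a * (r : ℝ) ^ 2)⁻¹ * (4 * a * (r : ℝ) ^ 2 *
      dirichletForm π P f) := mul_le_mul_of_nonneg_left h (inv_nonneg.2 h4.le)
    _ = dirichletForm π P f := by rw [← mul_assoc, inv_mul_cancel₀ h4.ne', one_mul]

end Core

/-! ## THEOREM 4.1 -/

section TheoremFourOne

/-- **THEOREM 4.1 (Goel–Montenegro–Tetali 2006).**  Let `(K,π)` be a finite chain (`π > 0` a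
probability vector, `|X| ≥ 2`) with a family of sets `B(x,r)` whose largest member is everything
(`B(x,γ) = X`, `γ` the diameter) and the **local Poincaré inequality with constant `a > 0`**:
`‖f − f_r‖₂² ≤ ar²𝓔(f,f)` for all `f` and all `r`.  Then for `π_* ≤ v ≤ 1/2` (some non-empty `S`
has `π(S) ≤ v`) **`Λ(v) ≥ 1/(4aW²(2v))`**, `W(v) = inf{r : V_*(r) ≥ v}` (when `W(2v) = 0` the
right side is `0` by the `x/0 = 0` convention and the claim is `Λ ≥ 0`).
[cite: GoelMontenegroTetali2006, §4.2.1 Theorem 4.1] -/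
theorem GoelMontenegroTetali2006_thm_4_1 [Nontrivial X] (hπ : ∀ y, 0 < π y) (hπ1 : ∑ y, π y = 1)
    (hP0 : ∀ x y, 0 ≤ P x y) {B : X → ℕ → Finset X} {γ : ℕ} (hγ : ∀ x, B x γ = univ) {a : ℝ}
    (ha : 0 < a)
    (hloc : ∀ (f : X → ℝ) (r : ℕ), piInner π (fun x => f x - setAverage π B r f x)
      (fun x => f x - setAverage π B r f x) ≤ a * (r : ℝ) ^ 2 * dirichletForm π P f)
    {v : ℝ} (hv : v ≤ 1 / 2) (hvS : ∃ S : Finset X, S.Nonempty ∧ ∑ x ∈ S, π x ≤ v) :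
    (4 * a * (volumeGrowthRadius π B (2 * v) : ℝ) ^ 2)⁻¹ ≤ spectralProfile π P v := by
  have hπ0 : ∀ y, 0 ≤ π y := fun y => (hπ y).le
  set W := volumeGrowthRadius π B (2 * v) with hW
  obtain ⟨S₀, hS₀, hS₀v⟩ := hvS
  rcases Nat.eq_zero_or_pos W with hW0 | hWpos
  · rw [hW0]; simp only [Nat.cast_zero]
    rw [show (4 * a * (0:ℝ) ^ 2)⁻¹ = 0 by simp]
    exact spectralProfile_nonneg hπ0 hP0 v
  -- `V_*(W(2v)) ≥ 2v` since `V_*(γ) = 1 ≥ 2v`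
  have hVγ : ∀ x, 2 * v ≤ ∑ y ∈ B x γ, π y := fun x => by rw [hγ x, hπ1]; linarith
  have hVW : ∀ x, 2 * v ≤ ∑ y ∈ B x W, π y := volumeGrowthRadius_spec hVγ
  have har : 0 < a * (W : ℝ) ^ 2 := mul_pos ha (pow_pos (by exact_mod_cast hWpos) 2)
  refine le_csInf ⟨_, ⟨S₀, ⟨hS₀, hS₀v⟩, rfl⟩⟩ ?_
  rintro _ ⟨S, ⟨hS, hSv⟩, rfl⟩
  have hVS : ∀ x, 2 * ∑ x ∈ S, π x ≤ ∑ y ∈ B x W, π y := fun x => (by linarith [hVW x])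
  calc (4 * a * (W : ℝ) ^ 2)⁻¹ ≤ dirichletEigenvalue₀ π P S :=
        GoelMontenegroTetali2006_thm_4_1_eigenvalue₀ hπ hP0 hS har hVS (fun f _ => hloc f W)
    _ ≤ dirichletEigenvalue π P S := dirichletEigenvalue₀_le_dirichletEigenvalue hπ hπ1 hP0 hS

end TheoremFourOne

/-! ## COROLLARY 4.2, first display: moderate growth bounds `W` -/

section ModerateGrowth

omit [DecidableEq X] in
/-- **`W(v) ≤ γ(Av)^{1/d}` under `(A,d)`-moderate growth** `V(x,r) ≥ A⁻¹((r+1)/γ)^d` (`0 ≤ r ≤ γ`,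
DEFINITION 4.2; `B(x,γ) = X`, `0 < v ≤ 1`, `A, d > 0`). [cite: GoelMontenegroTetali2006, §4.2.1
Definition 4.2 and proof of Corollary 4.2 ("By the moderate growth assumption, `W(v) ≤ γ(Av)^{1/d}`")] -/
theorem volumeGrowthRadius_le_of_moderateGrowth (hπ1 : ∑ y, π y = 1) {B : X → ℕ → Finset X} {γ : ℕ}
    (hγ : ∀ x, B x γ = univ) {A d : ℝ} (hA : 0 < A) (hd : 0 < d)
    (hgrowth : ∀ r : ℕ, r ≤ γ → ∀ x, A⁻¹ * (((r : ℝ) + 1) / γ) ^ d ≤ ∑ y ∈ B x r, π y)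
    {v : ℝ} (hv0 : 0 < v) (hv1 : v ≤ 1) :
    (volumeGrowthRadius π B v : ℝ) ≤ γ * (A * v) ^ (1 / d) := by
  have hAv : 0 < A * v := mul_pos hA hv0
  set c := (γ : ℝ) * (A * v) ^ (1 / d) with hc
  have hrhs : 0 ≤ c := mul_nonneg (Nat.cast_nonneg _) (Real.rpow_nonneg hAv.le _)
  -- either `c ≥ γ ≥ W(v)` (as `V_*(γ) = 1 ≥ v`), or the radius `r = ⌈c⌉₊ − 1 ≤ γ` qualifies
  have hWγ : volumeGrowthRadius π B v ≤ γ := volumeGrowthRadius_le fun x => by rw [hγ x, hπ1]; exact hv1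
  by_cases hcase : (γ : ℝ) ≤ c
  · exact le_trans (by exact_mod_cast hWγ) hcase
  rw [not_le] at hcase
  have hγpos : 0 < (γ : ℝ) := hrhs.trans_lt hcase
  have hc0 : 0 < c := mul_pos hγpos (Real.rpow_pos_of_pos hAv _)
  have hceil1 : 1 ≤ ⌈c⌉₊ := Nat.ceil_pos.2 hc0
  have hceilγ : ⌈c⌉₊ ≤ γ := Nat.ceil_le.2 hcase.le
  set r : ℕ := ⌈c⌉₊ - 1 with hr
  have hrγ : r ≤ γ := (Nat.sub_le _ _).trans hceilγ
  have hr1 : (r : ℝ) + 1 = ⌈c⌉₊ := by rw [hr, Nat.cast_sub hceil1]; push_cast; ring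
  have hcle : c ≤ (r : ℝ) + 1 := by rw [hr1]; exact Nat.le_ceil c
  have hrlt : (r : ℝ) < c := by
    have := Nat.ceil_lt_add_one hrhs; rw [← hr1] at this; linarith
  -- `V(x,r) ≥ A⁻¹((r+1)/γ)^d ≥ A⁻¹(c/γ)^d = v`
  have hVr : ∀ x, v ≤ ∑ y ∈ B x r, π y := by
    intro x
    refine le_trans ?_ (hgrowth r hrγ x)
    have hcγ : c / γ = (A * v) ^ (1 / d) := by rw [hc]; field_simp
    have hpow : (c / γ) ^ d = A * v := by
      rw [hcγ, ← Real.rpow_mul hAv.le, one_div_mul_cancel hd.ne', Real.rpow_one]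
    have hmono : (c / γ) ^ d ≤ (((r : ℝ) + 1) / γ) ^ d :=
      Real.rpow_le_rpow (div_nonneg hrhs hγpos.le) (div_le_div_of_nonneg_right hcle hγpos.le) hd.le
    rw [hpow] at hmono
    calc v = A⁻¹ * (A * v) := by field_simp
      _ ≤ A⁻¹ * (((r : ℝ) + 1) / γ) ^ d := mul_le_mul_of_nonneg_left hmono (inv_nonneg.2 hA.le)
  calc (volumeGrowthRadius π B v : ℝ) ≤ r := by exact_mod_cast volumeGrowthRadius_le hVr
    _ ≤ c := hrlt.le

omit [Fintype X] [DecidableEq X] in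
/-- With balls of radius `0` reduced to points (`B(x,0) = {x}`, so `V_*(0) = π_*`), **`W(2v) ≥ 1`
whenever `v ≥ π(S)` for some non-empty `S`** (`π > 0`, and some radius reaches volume `2v`).
[cite: GoelMontenegroTetali2006, §4.2.1 (the balls `B(x,r) = {z : d(x,z) ≤ r}` of Definition 4.2;
Theorem 4.1)] -/
theorem one_le_volumeGrowthRadius (hπ : ∀ y, 0 < π y) {B : X → ℕ → Finset X} (hB0 : ∀ x, B x 0 = {x})
    {v : ℝ} {R : ℕ} (hR : ∀ x, 2 * v ≤ ∑ y ∈ B x R, π y)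
    (hvS : ∃ S : Finset X, S.Nonempty ∧ ∑ x ∈ S, π x ≤ v) : 1 ≤ volumeGrowthRadius π B (2 * v) := by
  by_contra h
  have hW0 : volumeGrowthRadius π B (2 * v) = 0 := by omega
  obtain ⟨S, ⟨x, hx⟩, hSv⟩ := hvS
  have h1 := volumeGrowthRadius_spec hR x (π := π)
  rw [hW0, hB0 x, sum_singleton] at h1
  have h2 : π x ≤ ∑ y ∈ S, π y := single_le_sum (fun y _ => (hπ y).le) hx
  have h3 : 0 < ∑ y ∈ S, π y := sum_pos (fun y _ => hπ y) ⟨x, hx⟩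
  linarith

/-- **COROLLARY 4.2 (Goel–Montenegro–Tetali 2006), the spectral-profile display of its proof**:
under `(A,d)`-moderate growth (`B(x,γ) = X`, `B(x,0) = {x}`) and the local Poincaré inequality
with constant `a`, for `π_* ≤ v ≤ 1/2`: **`Λ(v) ≥ 1/(4aW²(2v)) ≥ 1/(4aγ²(2Av)^{2/d})`** (the
second inequality from `W(2v) ≤ γ(2Av)^{1/d}`; see the module docstring for the printed constant
`8aA^{1/d}`). [cite: GoelMontenegroTetali2006, §4.2.1 Corollary 4.2 (proof, first display)] -/
theorem GoelMontenegroTetali2006_cor_4_2_profile [Nontrivial X] (hπ : ∀ y, 0 < π y)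
    (hπ1 : ∑ y, π y = 1) (hP0 : ∀ x y, 0 ≤ P x y) {B : X → ℕ → Finset X} {γ : ℕ}
    (hB0 : ∀ x, B x 0 = {x}) (hγ : ∀ x, B x γ = univ) {a A d : ℝ} (ha : 0 < a) (hA : 0 < A)
    (hd : 0 < d) (hgrowth : ∀ r : ℕ, r ≤ γ → ∀ x, A⁻¹ * (((r : ℝ) + 1) / γ) ^ d ≤ ∑ y ∈ B x r, π y)
    (hloc : ∀ (f : X → ℝ) (r : ℕ), piInner π (fun x => f x - setAverage π B r f x)
      (fun x => f x - setAverage π B r f x) ≤ a * (r : ℝ) ^ 2 * dirichletForm π P f)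
    {v : ℝ} (hv : v ≤ 1 / 2) (hvS : ∃ S : Finset X, S.Nonempty ∧ ∑ x ∈ S, π x ≤ v) :
    (4 * a * (γ : ℝ) ^ 2 * (2 * A * v) ^ (2 / d))⁻¹ ≤ spectralProfile π P v := by
  have hv0 : 0 < v := by
    obtain ⟨S, hS, hSv⟩ := hvS; exact lt_of_lt_of_le (sum_pos (fun y _ => hπ y) hS) hSv
  have h41 := GoelMontenegroTetali2006_thm_4_1 hπ hπ1 hP0 hγ ha hloc hv hvS
  have hW := volumeGrowthRadius_le_of_moderateGrowth hπ1 hγ hA hd hgrowth (by linarith : 0 < 2 * v)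
    (by linarith : 2 * v ≤ 1) (B := B)
  have hVγ : ∀ x, 2 * v ≤ ∑ y ∈ B x γ, π y := fun x => by rw [hγ x, hπ1]; linarith
  have hW1 : (1 : ℝ) ≤ volumeGrowthRadius π B (2 * v) := by
    exact_mod_cast one_le_volumeGrowthRadius hπ hB0 hVγ hvS
  refine le_trans (inv_anti₀ (by positivity) ?_) h41
  -- `4aW(2v)² ≤ 4aγ²(2Av)^{2/d}`
  have hsq : (volumeGrowthRadius π B (2 * v) : ℝ) ^ 2 ≤ (γ : ℝ) ^ 2 * (2 * A * v) ^ (2 / d) := by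
    have h := pow_le_pow_left₀ (by positivity) hW 2
    rw [mul_pow, ← Real.rpow_natCast ((A * (2 * v)) ^ (1 / d)) 2,
      ← Real.rpow_mul (by positivity)] at h
    rw [show A * (2 * v) = 2 * A * v by ring, show (1:ℝ) / d * (2:ℕ) = 2 / d by push_cast; ring] at h
    exact h
  rw [mul_assoc (4 * a)]
  exact mul_le_mul_of_nonneg_left hsq (by positivity)

end ModerateGrowth

end Literature.Probability.MarkovChains
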